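import Literature.NumberTheory.Automorphic.AdelicThetaHeightBound
import Literature.NumberTheory.Automorphic.GodementJacquetThetaSeries
import Literature.NumberTheory.Automorphic.MirabolicEisensteinResidue
import Literature.NumberTheory.Automorphic.AdelicHeightGLSiegel
import HarnessLib

/-!
# Slow growth of the matrix theta series `Σ_{ξ ∈ M_n(K)} |Φ(A ξ B)|` in the archimedean heights

Topic `NumberTheory/Automorphic`; namespace `Literature.NumberTheory.Automorphic`. The input
"the theta series is slowly increasing" to the absolute convergence of the singular terms of the
Godement–Jacquet functional equation against cusp forms (Godement–Jacquet, LNM 260 (1972), §11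
Lemma 11.5–11.6 and §12; Jacquet, *Principal L-functions of the linear group* (1979), §1), for the
two-sided matrix theta series of `GodementJacquetThetaSeries`:

* decay: every `Ψ ∈ 𝒮(𝔸_Kᴺ)` satisfies `|Ψ(x)| ≤ M (1 + ‖x_∞‖)^{-k}` and vanishes unless `x_f`
  lies in a compact set (`exists_decay_of_mem_piSchwartzBruhat`, `MirabolicEisensteinResidue`);
* vectorisation: `vecOfMatrix`, `matOfVec`, `vecMatrixEquiv`; the **Kronecker matrix**
  `kronMat A B = reindex (Aᵀ ⊗ B)` of `ξ ↦ A ξ B` (`vecOfMatrix_mul_mul : vec(A M B) = vec(M) · kron(A, B)`),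
  its multiplicativity, the unit `kronGL A B ∈ GL_{n²}` with `(kronGL A B)⁻¹ = kronGL A⁻¹ B⁻¹`,
  functoriality `map_kronGL` and continuity `continuous_kronGL`;
* over the adeles: `archHeight_kronGL_le` — **`H_∞(kron(A, B)) ≤ H_∞(A) H_∞(B)`**;
  `sndHom_kronGL` — the finite part of `kron(A, B)` is `kron(A_f, B_f)`;
  `apply_mul_ratMatrix_mul_eq` — `Φ(A ξ B) = (Φ ∘ matOfVec)(vec ξ · kron(A, B))`;
  `comp_matOfVec_mem_piSchwartzBruhat`;
* `norm_apply_vecMul_le_of_decay`, `summable_indicator_rpow_neg`, `continuous_tsum_mul_ratMatrix_mul` —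
  **the theta series `(A, B) ↦ Σ_{ξ ∈ S} Φ(A ξ B)` (any `S ⊆ M_n(K)`) is continuous on
  `GL_n(𝔸_K) × GL_n(𝔸_K)`** (termwise domination on compact sets, Weierstrass `M`-test);
* `exists_tsum_enorm_mul_ratMatrix_mul_le` — **main**: for `Φ ∈ 𝒮(M_n(𝔸_K))`, compact
  `𝒜, ℬ ⊆ GL_n(𝔸_K^∞)` and `θ > n² [K:ℚ]` there is `B < ∞` with
  `Σ_{ξ ∈ M_n(K)} |Φ(A ξ B')| ≤ B (1 ⊔ n⁴ H_∞(A) H_∞(B'))^θ` whenever `A_f ∈ 𝒜`, `B'_f ∈ ℬ`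
  (`exists_tsum_enorm_vecMul_le_archHeight_rpow` of `AdelicThetaHeightBound`).

## References

* R. Godement, H. Jacquet, *Zeta functions of simple algebras*, LNM 260 (1972), §11–12
  [GodementJacquetLNM260].
* H. Jacquet, *Principal L-functions of the linear group*, Proc. Sympos. Pure Math. 33.2 (1979), §1
  [folklore].
-/

noncomputable section

open scoped NNReal ENNReal Pointwise Classical RestrictedProduct Kronecker
open NumberField NumberField.mixedEmbedding IsDedekindDomain Set MeasureTheory Measure Matrix Module

namespace Literature.NumberTheory.Automorphic

/-! ### Vectorising matrices: `ξ ↦ A ξ B` as a row-vector action of a Kronecker matrix -/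

section Kronecker

variable {n : ℕ}

/-- The index bijection `Fin n × Fin n ≃ Fin (n·n)` (Mathlib `finProdFinEquiv`). [folklore] -/
abbrev matIdx (n : ℕ) : Fin n × Fin n ≃ Fin (n * n) := finProdFinEquiv

/-- Vectorisation of an `n × n` matrix as a vector of length `n·n`. [folklore] -/
def vecOfMatrix {R : Type*} (M : Matrix (Fin n) (Fin n) R) : Fin (n * n) → R :=
  fun p => M ((matIdx n).symm p).1 ((matIdx n).symm p).2

/-- The matrix of a vector of length `n·n`. [folklore] -/
def matOfVec {R : Type*} (v : Fin (n * n) → R) : Matrix (Fin n) (Fin n) R :=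
  Matrix.of fun i j => v (matIdx n (i, j))

/-- Unfolding of `vecOfMatrix`. [folklore] -/
theorem vecOfMatrix_apply {R : Type*} (M : Matrix (Fin n) (Fin n) R) (p : Fin (n * n)) :
    vecOfMatrix M p = M ((matIdx n).symm p).1 ((matIdx n).symm p).2 := rfl

/-- Unfolding of `matOfVec`. [folklore] -/
theorem matOfVec_apply {R : Type*} (v : Fin (n * n) → R) (i j : Fin n) :
    matOfVec v i j = v (matIdx n (i, j)) := rfl

/-- `matOfVec ∘ vecOfMatrix = id`. [folklore] -/
theorem matOfVec_vecOfMatrix {R : Type*} (M : Matrix (Fin n) (Fin n) R) : matOfVec (vecOfMatrix M) = M := by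
  ext i j
  rw [matOfVec_apply, vecOfMatrix_apply, Equiv.symm_apply_apply]

/-- `vecOfMatrix ∘ matOfVec = id`. [folklore] -/
theorem vecOfMatrix_matOfVec {R : Type*} (v : Fin (n * n) → R) : vecOfMatrix (matOfVec v) = v := by
  funext p
  rw [vecOfMatrix_apply, matOfVec_apply, Prod.mk.eta, Equiv.apply_symm_apply]

/-- Vectorisation as a bijection. [folklore] -/
def vecMatrixEquiv (R : Type*) : Matrix (Fin n) (Fin n) R ≃ (Fin (n * n) → R) where
  toFun := vecOfMatrix
  invFun := matOfVec
  left_inv := matOfVec_vecOfMatrix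
  right_inv := vecOfMatrix_matOfVec

/-- **The Kronecker matrix of `ξ ↦ A ξ B`** on vectorised matrices: the reindexing of `Aᵀ ⊗ B`.
[folklore] -/
def kronMat {R : Type*} [CommRing R] (A B : Matrix (Fin n) (Fin n) R) : Matrix (Fin (n * n)) (Fin (n * n)) R :=
  Matrix.reindex (matIdx n) (matIdx n) (Aᵀ ⊗ₖ B)

/-- Entries of the Kronecker matrix. [folklore] -/
theorem kronMat_apply {R : Type*} [CommRing R] (A B : Matrix (Fin n) (Fin n) R) (p q : Fin (n * n)) :
    kronMat A B p q = A ((matIdx n).symm q).1 ((matIdx n).symm p).1 * B ((matIdx n).symm p).2 ((matIdx n).symm q).2 := by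
  rw [kronMat, Matrix.reindex_apply, Matrix.submatrix_apply]
  rfl

/-- **`vec(A M B) = vec(M) · kron(A, B)`.** [folklore] -/
theorem vecOfMatrix_mul_mul {R : Type*} [CommRing R] (A M B : Matrix (Fin n) (Fin n) R) :
    vecOfMatrix (A * M * B) = vecOfMatrix M ᵥ* kronMat A B := by
  funext q
  rw [vecOfMatrix_apply, Matrix.vecMul, dotProduct]
  simp_rw [kronMat_apply, vecOfMatrix_apply]
  rw [← (matIdx n).sum_comp]
  simp_rw [Equiv.symm_apply_apply]
  rw [Fintype.sum_prod_type, Matrix.mul_apply]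
  simp_rw [Matrix.mul_apply, Finset.sum_mul]
  rw [Finset.sum_comm]
  refine Finset.sum_congr rfl fun k _ => Finset.sum_congr rfl fun l _ => ?_
  ring

/-- Multiplicativity: `kron(A, B) kron(C, D) = kron(C A, B D)`. [folklore] -/
theorem kronMat_mul_kronMat {R : Type*} [CommRing R] (A B C D : Matrix (Fin n) (Fin n) R) :
    kronMat A B * kronMat C D = kronMat (C * A) (B * D) := by
  unfold kronMat
  rw [Matrix.reindex_apply, Matrix.reindex_apply, Matrix.reindex_apply, Matrix.submatrix_mul_equiv,
    ← Matrix.mul_kronecker_mul, ← Matrix.transpose_mul]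

/-- `kron(1, 1) = 1`. [folklore] -/
theorem kronMat_one_one {R : Type*} [CommRing R] : kronMat (1 : Matrix (Fin n) (Fin n) R) 1 = 1 := by
  unfold kronMat
  rw [Matrix.transpose_one, Matrix.one_kronecker_one, Matrix.reindex_apply, Matrix.submatrix_one_equiv]

/-- **The Kronecker matrix of invertible `A, B` is invertible**, with inverse `kron(A⁻¹, B⁻¹)`.
[folklore] -/
def kronGL {R : Type*} [CommRing R] (A B : GL (Fin n) R) : GL (Fin (n * n)) R where
  val := kronMat (A : Matrix (Fin n) (Fin n) R) (B : Matrix (Fin n) (Fin n) R)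
  inv := kronMat ((A⁻¹ : GL (Fin n) R) : Matrix (Fin n) (Fin n) R) ((B⁻¹ : GL (Fin n) R) : Matrix (Fin n) (Fin n) R)
  val_inv := by
    rw [kronMat_mul_kronMat, ← Matrix.GeneralLinearGroup.coe_mul, ← Matrix.GeneralLinearGroup.coe_mul,
      inv_mul_cancel, mul_inv_cancel, Matrix.GeneralLinearGroup.coe_one, kronMat_one_one]
  inv_val := by
    rw [kronMat_mul_kronMat, ← Matrix.GeneralLinearGroup.coe_mul, ← Matrix.GeneralLinearGroup.coe_mul,
      mul_inv_cancel, inv_mul_cancel, Matrix.GeneralLinearGroup.coe_one, kronMat_one_one]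

/-- Underlying matrix of `kronGL`. [folklore] -/
theorem coe_kronGL {R : Type*} [CommRing R] (A B : GL (Fin n) R) :
    ((kronGL A B : GL (Fin (n * n)) R) : Matrix (Fin (n * n)) (Fin (n * n)) R) =
      kronMat (A : Matrix (Fin n) (Fin n) R) (B : Matrix (Fin n) (Fin n) R) := rfl

/-- Inverse of `kronGL`. [folklore] -/
theorem kronGL_inv {R : Type*} [CommRing R] (A B : GL (Fin n) R) :
    (kronGL A B)⁻¹ = kronGL A⁻¹ B⁻¹ :=
  inv_eq_of_mul_eq_one_right (Units.ext (by
    rw [Units.val_mul, coe_kronGL, coe_kronGL, Units.val_one, kronMat_mul_kronMat,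
      ← Matrix.GeneralLinearGroup.coe_mul, ← Matrix.GeneralLinearGroup.coe_mul, inv_mul_cancel,
      mul_inv_cancel, Matrix.GeneralLinearGroup.coe_one, kronMat_one_one]))

/-- `kronGL` along a ring homomorphism. [folklore] -/
theorem map_kronGL {R S : Type*} [CommRing R] [CommRing S] (f : R →+* S) (A B : GL (Fin n) R) :
    Matrix.GeneralLinearGroup.map f (kronGL A B) =
      kronGL (Matrix.GeneralLinearGroup.map f A) (Matrix.GeneralLinearGroup.map f B) := by
  refine Units.ext (Matrix.ext fun p q => ?_)
  change f (kronMat (A : Matrix (Fin n) (Fin n) R) (B : Matrix (Fin n) (Fin n) R) p q) = _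
  rw [coe_kronGL, kronMat_apply, kronMat_apply, map_mul]
  rfl

/-- `kronGL` is continuous on `GL_n × GL_n` (topological ring `R`). [folklore] -/
theorem continuous_kronGL {R : Type*} [CommRing R] [TopologicalSpace R] [IsTopologicalRing R] :
    Continuous fun p : GL (Fin n) R × GL (Fin n) R => kronGL p.1 p.2 := by
  refine Units.continuous_iff.2 ⟨?_, ?_⟩
  · refine continuous_matrix fun p q => ?_
    simp only [Function.comp_apply, coe_kronGL, kronMat_apply]
    exact ((Units.continuous_val.comp continuous_fst).matrix_elem _ _).mul
      ((Units.continuous_val.comp continuous_snd).matrix_elem _ _)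
  · simp_rw [kronGL_inv]
    refine continuous_matrix fun p q => ?_
    simp only [coe_kronGL, kronMat_apply]
    exact ((Units.continuous_coe_inv.comp continuous_fst).matrix_elem _ _).mul
      ((Units.continuous_coe_inv.comp continuous_snd).matrix_elem _ _)

end Kronecker

/-! ### Heights and finite parts of the Kronecker matrix over the adeles -/

section Adelic

variable {K : Type} [Field K] [NumberField K] {n : ℕ}

/-- Entries of the archimedean component are bounded by the archimedean height. [folklore] -/
theorem nnnorm_toMixed_apply_le (A : GL (Fin n) (AdeleRing (𝓞 K) K)) (i j : Fin n) :
    ‖((GLn.toMixed n K A : GL (Fin n) (mixedSpace K)) : Matrix (Fin n) (Fin n) (mixedSpace K)) i j‖₊ ≤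
      GLn.archHeight n K A :=
  nnnorm_apply_le_sup (GLn.toMixed n K A) i j

/-- Entries of the inverse archimedean component are bounded by the archimedean height. [folklore] -/
theorem nnnorm_toMixed_inv_apply_le (A : GL (Fin n) (AdeleRing (𝓞 K) K)) (i j : Fin n) :
    ‖((GLn.toMixed n K A⁻¹ : GL (Fin n) (mixedSpace K)) : Matrix (Fin n) (Fin n) (mixedSpace K)) i j‖₊ ≤
      GLn.archHeight n K A := by
  rw [map_inv]
  exact nnnorm_inv_apply_le_sup (GLn.toMixed n K A) i j

/-- Entries of the archimedean component of the Kronecker matrix are products of entries.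
[folklore] -/
theorem toMixed_kronGL_apply (A B : GL (Fin n) (AdeleRing (𝓞 K) K)) (p q : Fin (n * n)) :
    ((GLn.toMixed (n * n) K (kronGL A B) : GL (Fin (n * n)) (mixedSpace K)) :
        Matrix (Fin (n * n)) (Fin (n * n)) (mixedSpace K)) p q =
      ((GLn.toMixed n K A : GL (Fin n) (mixedSpace K)) : Matrix (Fin n) (Fin n) (mixedSpace K))
          ((matIdx n).symm q).1 ((matIdx n).symm p).1 *
        ((GLn.toMixed n K B : GL (Fin n) (mixedSpace K)) : Matrix (Fin n) (Fin n) (mixedSpace K))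
          ((matIdx n).symm p).2 ((matIdx n).symm q).2 := by
  change InfiniteAdeleRing.ringEquiv_mixedSpace K
      ((((kronGL A B : GL (Fin (n * n)) (AdeleRing (𝓞 K) K)) :
        Matrix (Fin (n * n)) (Fin (n * n)) (AdeleRing (𝓞 K) K)) p q).1) =
    InfiniteAdeleRing.ringEquiv_mixedSpace K
        (((A : Matrix (Fin n) (Fin n) (AdeleRing (𝓞 K) K)) ((matIdx n).symm q).1 ((matIdx n).symm p).1).1) *
      InfiniteAdeleRing.ringEquiv_mixedSpace K
        (((B : Matrix (Fin n) (Fin n) (AdeleRing (𝓞 K) K)) ((matIdx n).symm p).2 ((matIdx n).symm q).2).1)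
  rw [coe_kronGL, kronMat_apply, ← map_mul]
  rfl

/-- **`H_∞(kron(A, B)) ≤ H_∞(A) H_∞(B)`.** [folklore] -/
theorem archHeight_kronGL_le (A B : GL (Fin n) (AdeleRing (𝓞 K) K)) :
    GLn.archHeight (n * n) K (kronGL A B) ≤ GLn.archHeight n K A * GLn.archHeight n K B := by
  unfold GLn.archHeight
  refine Finset.sup_le fun pq _ => sup_le ?_ ?_
  · rw [toMixed_kronGL_apply]
    exact (nnnorm_mul_le _ _).trans (mul_le_mul' (nnnorm_toMixed_apply_le A _ _) (nnnorm_toMixed_apply_le B _ _))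
  · rw [← map_inv, kronGL_inv, toMixed_kronGL_apply]
    exact (nnnorm_mul_le _ _).trans
      (mul_le_mul' (nnnorm_toMixed_inv_apply_le A _ _) (nnnorm_toMixed_inv_apply_le B _ _))

/-- The finite part of the Kronecker matrix is the Kronecker matrix of the finite parts. [folklore] -/
theorem sndHom_kronGL (A B : GL (Fin n) (AdeleRing (𝓞 K) K)) :
    GLn.sndHom (n * n) K (kronGL A B) = kronGL (GLn.sndHom n K A) (GLn.sndHom n K B) :=
  map_kronGL _ A B

/-- Vectorisation commutes with the embedding of rational matrices. [folklore] -/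
theorem vecOfMatrix_ratMatrix (ξ : Matrix (Fin n) (Fin n) K) :
    vecOfMatrix (ratMatrix n K ξ) = ratVec K (vecOfMatrix ξ) := rfl

/-- **`Φ(A ξ B) = Ψ(vec(ξ) · kron(A, B))`** with `Ψ = Φ ∘ matOfVec`. [folklore] -/
theorem apply_mul_ratMatrix_mul_eq (Φ : Matrix (Fin n) (Fin n) (AdeleRing (𝓞 K) K) → ℂ)
    (A B : GL (Fin n) (AdeleRing (𝓞 K) K)) (ξ : Matrix (Fin n) (Fin n) K) :
    Φ ((A : Matrix (Fin n) (Fin n) (AdeleRing (𝓞 K) K)) * ratMatrix n K ξ *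
        (B : Matrix (Fin n) (Fin n) (AdeleRing (𝓞 K) K))) =
      (fun x => Φ (matOfVec x)) (ratVec K (vecOfMatrix ξ) ᵥ*
        ((kronGL A B : GL (Fin (n * n)) (AdeleRing (𝓞 K) K)) : Matrix (Fin (n * n)) (Fin (n * n)) (AdeleRing (𝓞 K) K))) := by
  simp only
  rw [coe_kronGL, ← vecOfMatrix_ratMatrix, ← vecOfMatrix_mul_mul, matOfVec_vecOfMatrix]

/-- `Φ ∘ matOfVec ∈ 𝒮(𝔸_K^{n·n})` for `Φ ∈ 𝒮(M_n(𝔸_K))`. [folklore] -/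
theorem comp_matOfVec_mem_piSchwartzBruhat {Φ : Matrix (Fin n) (Fin n) (AdeleRing (𝓞 K) K) → ℂ}
    (hΦ : Φ ∈ schwartzBruhatAdelicMatrix n K) :
    (fun x : Fin (n * n) → AdeleRing (𝓞 K) K => Φ (matOfVec x)) ∈ piSchwartzBruhat K (Fin (n * n)) := by
  have h := comp_equiv_mem_piSchwartzBruhat (mem_piSchwartzBruhat_of_mem_schwartzBruhatAdelicMatrix hΦ) (matIdx n)
  have he : (fun x : Fin (n * n) → AdeleRing (𝓞 K) K => Φ (matOfVec x)) =
      fun w => Φ (matrixOfPi n (w ∘ matIdx n)) := by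
    funext x
    rfl
  rw [he]
  exact h

end Adelic

/-! ### Continuity of the matrix theta series in `(A, B)` (Weierstrass `M`-test) -/

section Continuity

variable {K : Type} [Field K] [NumberField K] {N n : ℕ}

/-- **Termwise bound**: under the hypotheses of `tsum_enorm_vecMul_le_of_decay`, for `ξ ≠ 0`,
`|Ψ(ξ L)| ≤ M G^θ ‖ξ_∞‖^{-θ} 𝟙_{C'}(ξ_f)`. [folklore] -/
theorem norm_apply_vecMul_le_of_decay {Ψ : (Fin N → AdeleRing (𝓞 K) K) → ℂ} {k : ℕ} {M : ℝ}
    (hM0 : 0 ≤ M) (hM : ∀ x, ‖Ψ x‖ ≤ M * (1 + ‖vecInfinitePart K N x‖) ^ (-(k : ℝ)))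
    {Cf : Set (Fin N → FiniteAdeleRing (𝓞 K) K)} (hCf : ∀ x, vecFinitePart K N x ∉ Cf → Ψ x = 0)
    {C' : Set (Fin N → FiniteAdeleRing (𝓞 K) K)} (L : GL (Fin N) (AdeleRing (𝓞 K) K))
    (hL : ∀ v : Fin N → K,
      vecFinitePart K N (ratVec K v ᵥ* (L : Matrix (Fin N) (Fin N) (AdeleRing (𝓞 K) K))) ∈ Cf →
        vecFinitePart K N (ratVec K v) ∈ C')
    {G : ℝ} (hG0 : 0 < G)
    (hGL : (∑ k, ∑ l, ‖(((L⁻¹ : GL (Fin N) (AdeleRing (𝓞 K) K)) :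
          Matrix (Fin N) (Fin N) (AdeleRing (𝓞 K) K)).map
            fun a => InfiniteAdeleRing.ringEquiv_mixedSpace K a.1) k l‖) ≤ G)
    {θ : ℝ} (hθ0 : 0 ≤ θ) (hθk : θ ≤ k) {v : Fin N → K} (hv : v ≠ 0) :
    ‖Ψ (ratVec K v ᵥ* (L : Matrix (Fin N) (Fin N) (AdeleRing (𝓞 K) K)))‖ ≤
      C'.indicator (fun _ => M * G⁻¹ ^ (-θ) * ‖vecInfinitePart K N (ratVec K v)‖ ^ (-θ)) (vecFinitePart K N (ratVec K v)) := by
  by_cases hC : vecFinitePart K N (ratVec K v ᵥ* (L : Matrix (Fin N) (Fin N) (AdeleRing (𝓞 K) K))) ∈ Cf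
  · rw [indicator_of_mem (hL v hC)]
    have hNpos : 0 < ‖vecInfinitePart K N (ratVec K v)‖ := by
      have h := norm_vecInfinitePart_ratVec_vecMul_pos K hv (1 : GL (Fin N) (AdeleRing (𝓞 K) K))
      rwa [Matrix.GeneralLinearGroup.coe_one, Matrix.vecMul_one] at h
    have hlow : G⁻¹ * ‖vecInfinitePart K N (ratVec K v)‖ ≤
        ‖vecInfinitePart K N (ratVec K v ᵥ* (L : Matrix (Fin N) (Fin N) (AdeleRing (𝓞 K) K)))‖ := by
      rw [inv_mul_le_iff₀ hG0]
      exact (norm_vecInfinitePart_ratVec_le_mul K v L).trans (mul_le_mul_of_nonneg_right hGL (norm_nonneg _))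
    exact le_mul_rpow_neg_mul_rpow_neg hM0 (hM _) (inv_pos.2 hG0) hNpos hlow hθ0 hθk
  · rw [hCf _ hC, norm_zero]
    exact Set.indicator_nonneg (fun _ _ => mul_nonneg (mul_nonneg hM0 (Real.rpow_nonneg (inv_pos.2 hG0).le _))
      (Real.rpow_nonneg (norm_nonneg _) _)) _

/-- **The majorant family is summable**: `Σ_{ξ ≠ 0, ξ_f ∈ C'} ‖ξ_∞‖^{-θ} < ∞` as a real series
indexed by all of `Kᴺ` (the term `ξ = 0` set to any constant), `θ > N [K:ℚ]`. [folklore] -/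
theorem summable_indicator_rpow_neg {C' : Set (Fin N → FiniteAdeleRing (𝓞 K) K)} (hC' : IsCompact C')
    {θ : ℝ} (hθ : (N : ℝ) * Module.finrank ℚ K < θ) (c₀ c : ℝ) :
    Summable fun v : Fin N → K => if v = 0 then c₀ else
      C'.indicator (fun _ => c * ‖vecInfinitePart K N (ratVec K v)‖ ^ (-θ)) (vecFinitePart K N (ratVec K v)) := by
  -- the `ℝ≥0∞` lattice sum at `L = 1` is finite
  have hZ := tsum_norm_vecInfinitePart_rpow_neg_lt_top K (n := N) (1 : GL (Fin N) (AdeleRing (𝓞 K) K)) hC' hθ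
  simp only [Matrix.GeneralLinearGroup.coe_one, Matrix.vecMul_one] at hZ
  set Λ : Set (Fin N → K) := {v | v ≠ 0 ∧ vecFinitePart K N (ratVec K v) ∈ C'} with hΛ
  have hS : {v : Fin N → K | v ≠ 0 ∧ vecFinitePart K N (ratVec K v ᵥ*
      (1 : Matrix (Fin N) (Fin N) (AdeleRing (𝓞 K) K))) ∈ C'} = Λ := by
    ext v
    simp only [Matrix.vecMul_one, mem_setOf_eq, hΛ]
  rw [tsum_congr_set_coe (fun v : Fin N → K => ENNReal.ofReal (‖vecInfinitePart K N (ratVec K v)‖ ^ (-θ))) hS] at hZ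
  -- the real family on `Λ` is summable
  have hsumΛ : Summable fun v : Λ => ‖vecInfinitePart K N (ratVec K (v : Fin N → K))‖ ^ (-θ) := by
    have h := ENNReal.summable_toReal hZ.ne
    refine h.congr fun v => ?_
    rw [ENNReal.toReal_ofReal (Real.rpow_nonneg (norm_nonneg _) _)]
  -- extend by zero outside `Λ` and add the term at `0`
  have hind : Summable fun v : Fin N → K => Λ.indicator (fun v => c * ‖vecInfinitePart K N (ratVec K v)‖ ^ (-θ)) v :=
    (summable_subtype_iff_indicator.1 (hsumΛ.mul_left c))
  refine (hind.update 0 c₀).congr fun v => ?_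
  by_cases hv : v = 0
  · subst hv
    rw [Function.update_self, if_pos rfl]
  · rw [Function.update_of_ne hv, if_neg hv]
    by_cases hmem : vecFinitePart K N (ratVec K v) ∈ C'
    · rw [indicator_of_mem hmem, indicator_of_mem (show v ∈ Λ from ⟨hv, hmem⟩)]
    · rw [indicator_of_notMem hmem, indicator_of_notMem (show v ∉ Λ from fun h => hmem h.2)]

/-- `Φ ∈ 𝒮(M_n(𝔸_K))` is continuous (through `𝒮(𝔸_K^{n·n})`). [folklore] -/
theorem continuous_of_mem_schwartzBruhatAdelicMatrix' {Φ : Matrix (Fin n) (Fin n) (AdeleRing (𝓞 K) K) → ℂ}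
    (hΦ : Φ ∈ schwartzBruhatAdelicMatrix n K) : Continuous Φ := by
  have h := continuous_of_mem_piSchwartzBruhat (comp_matOfVec_mem_piSchwartzBruhat hΦ)
  have hv : Continuous (vecOfMatrix : Matrix (Fin n) (Fin n) (AdeleRing (𝓞 K) K) → Fin (n * n) → AdeleRing (𝓞 K) K) :=
    continuous_pi fun p => (continuous_apply ((matIdx n).symm p).2).comp (continuous_apply ((matIdx n).symm p).1)
  exact (h.comp hv).congr fun M => by simp only [Function.comp_apply, matOfVec_vecOfMatrix]

/-- **The matrix theta series is continuous in `(A, B)`**: for `Φ ∈ 𝒮(M_n(𝔸_K))` and any set `S`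
of rational matrices, `(A, B) ↦ Σ_{ξ ∈ S} Φ(A ξ B)` is continuous on `GL_n(𝔸_K) × GL_n(𝔸_K)`
(locally uniform convergence: on a compact set the terms are dominated by the summable family
`M G₀^θ ‖ξ_∞‖^{-θ} 𝟙_{C'}(ξ_f)`, `norm_apply_vecMul_le_of_decay`; Weierstrass `M`-test,
Mathlib `continuousOn_tsum`). In particular the full, regular and singular theta series
`gjTheta`, `gjThetaReg`, `gjThetaSing` of `GodementJacquetThetaSeries` are continuous in their two
group variables. Godement–Jacquet (1972), §11. [cite: GodementJacquetLNM260, §11] -/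
theorem continuous_tsum_mul_ratMatrix_mul {Φ : Matrix (Fin n) (Fin n) (AdeleRing (𝓞 K) K) → ℂ}
    (hΦ : Φ ∈ schwartzBruhatAdelicMatrix n K) (S : Set (Matrix (Fin n) (Fin n) K)) :
    Continuous fun p : GL (Fin n) (AdeleRing (𝓞 K) K) × GL (Fin n) (AdeleRing (𝓞 K) K) =>
      ∑' ξ : S, Φ ((p.1 : Matrix (Fin n) (Fin n) (AdeleRing (𝓞 K) K)) * ratMatrix n K (ξ : Matrix (Fin n) (Fin n) K) *
        (p.2 : Matrix (Fin n) (Fin n) (AdeleRing (𝓞 K) K))) := by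
  haveI : LocallyCompactSpace (GL (Fin n) (AdeleRing (𝓞 K) K)) :=
    AdelicGroupData.locallyCompactSpace_generalLinearGroup_adeleRing K (Fin n)
  have hΦc := continuous_of_mem_schwartzBruhatAdelicMatrix' hΦ
  -- exponents and the decay data
  set d : ℕ := Module.finrank ℚ K with hd
  set θ : ℝ := ((n * n : ℕ) : ℝ) * d + 1 with hθdef
  have hθ : ((n * n : ℕ) : ℝ) * Module.finrank ℚ K < θ := lt_add_one _
  have hθ0 : 0 ≤ θ := le_trans (by positivity) hθ.le
  set k : ℕ := ⌈θ⌉₊ with hk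
  have hθk : θ ≤ k := Nat.le_ceil θ
  obtain ⟨M, hM0, Cf, hCfc, hd', hs'⟩ :=
    exists_decay_of_mem_piSchwartzBruhat (comp_matOfVec_mem_piSchwartzBruhat hΦ) k
  -- continuity at each point, through a compact neighbourhood
  rw [continuous_iff_continuousAt]
  intro p₀
  obtain ⟨Cp, hCpc, hCp⟩ := exists_compact_mem_nhds p₀
  refine ContinuousOn.continuousAt ?_ hCp
  -- the compact set of finite parts of the Kronecker matrices, and the lattice condition
  have hc1 : Continuous fun p : GL (Fin n) (AdeleRing (𝓞 K) K) × GL (Fin n) (AdeleRing (𝓞 K) K) =>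
      (GLn.sndHom n K p.1, GLn.sndHom n K p.2) :=
    (GLn.continuous_sndHom.comp continuous_fst).prodMk (GLn.continuous_sndHom.comp continuous_snd)
  have hc2 : Continuous ((fun q : GL (Fin n) (FiniteAdeleRing (𝓞 K) K) × GL (Fin n) (FiniteAdeleRing (𝓞 K) K) =>
      kronGL q.1 q.2) ∘ (fun p : GL (Fin n) (AdeleRing (𝓞 K) K) × GL (Fin n) (AdeleRing (𝓞 K) K) =>
        (GLn.sndHom n K p.1, GLn.sndHom n K p.2))) := continuous_kronGL.comp hc1
  have h𝒴 : IsCompact (((fun q : GL (Fin n) (FiniteAdeleRing (𝓞 K) K) × GL (Fin n) (FiniteAdeleRing (𝓞 K) K) =>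
      kronGL q.1 q.2) ∘ (fun p : GL (Fin n) (AdeleRing (𝓞 K) K) × GL (Fin n) (AdeleRing (𝓞 K) K) =>
        (GLn.sndHom n K p.1, GLn.sndHom n K p.2))) '' Cp) := hCpc.image hc2
  obtain ⟨C', hC'c, hC'⟩ := exists_isCompact_vecFinitePart_mem K (N := n * n) hCfc h𝒴
  -- a uniform bound for the heights on `Cp`
  have hHc : Continuous fun p : GL (Fin n) (AdeleRing (𝓞 K) K) × GL (Fin n) (AdeleRing (𝓞 K) K) =>
      ((n * n : ℕ) : ℝ) ^ 2 * (GLn.archHeight (n * n) K (kronGL p.1 p.2) : ℝ) :=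
    continuous_const.mul (NNReal.continuous_coe.comp ((GLn.continuous_archHeight (n := n * n) (K := K)).comp
      (continuous_kronGL.comp (continuous_fst.prodMk continuous_snd))))
  obtain ⟨G₁, hG₁⟩ := hCpc.exists_bound_of_continuousOn hHc.continuousOn
  set G₀ : ℝ := max 1 G₁ with hG₀
  have hG₀0 : 0 < G₀ := one_pos.trans_le (le_max_left _ _)
  have hGL : ∀ p ∈ Cp, (∑ k, ∑ l, ‖((((kronGL p.1 p.2)⁻¹ : GL (Fin (n * n)) (AdeleRing (𝓞 K) K)) :
      Matrix (Fin (n * n)) (Fin (n * n)) (AdeleRing (𝓞 K) K)).map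
        fun a => InfiniteAdeleRing.ringEquiv_mixedSpace K a.1) k l‖) ≤ G₀ := by
    intro p hp
    refine (sum_norm_inv_arch_le_mul_archHeight K (kronGL p.1 p.2)).trans ?_
    exact ((Real.le_norm_self _).trans (hG₁ p hp)).trans (le_max_right _ _)
  -- the summable majorant
  set u : Matrix (Fin n) (Fin n) K → ℝ := fun ξ => if vecOfMatrix ξ = 0 then M else
    C'.indicator (fun _ => M * G₀⁻¹ ^ (-θ) * ‖vecInfinitePart K (n * n) (ratVec K (vecOfMatrix ξ))‖ ^ (-θ))
      (vecFinitePart K (n * n) (ratVec K (vecOfMatrix ξ))) with hu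
  have husum : Summable u := by
    have h := summable_indicator_rpow_neg (K := K) (N := n * n) hC'c hθ M (M * G₀⁻¹ ^ (-θ))
    have h' := (vecMatrixEquiv K (n := n)).summable_iff.2 h
    refine h'.congr fun ξ => ?_
    simp only [Function.comp_apply, hu]
    rfl
  refine continuousOn_tsum (fun ξ => ?_) (husum.subtype S) (fun ξ p hp => ?_)
  · exact (hΦc.comp (((Units.continuous_val.comp continuous_fst).mul continuous_const).mul
      (Units.continuous_val.comp continuous_snd))).continuousOn
  · -- the termwise bound at `p ∈ Cp`
    show ‖Φ ((p.1 : Matrix (Fin n) (Fin n) (AdeleRing (𝓞 K) K)) * ratMatrix n K (ξ : Matrix (Fin n) (Fin n) K) *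
        (p.2 : Matrix (Fin n) (Fin n) (AdeleRing (𝓞 K) K)))‖ ≤ u ξ
    rw [apply_mul_ratMatrix_mul_eq Φ p.1 p.2 ξ]
    simp only [hu]
    by_cases hv : vecOfMatrix (ξ : Matrix (Fin n) (Fin n) K) = 0
    · rw [if_pos hv, hv]
      have hz : ratVec K (0 : Fin (n * n) → K) = 0 := by funext i; simp [ratVec]
      rw [hz, Matrix.zero_vecMul]
      refine (hd' 0).trans ?_
      have h1 : (1 + ‖vecInfinitePart K (n * n) (0 : Fin (n * n) → AdeleRing (𝓞 K) K)‖) ^ (-(k : ℝ)) ≤ 1 :=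
        Real.rpow_le_one_of_one_le_of_nonpos (by linarith [norm_nonneg (vecInfinitePart K (n * n) (0 : Fin (n * n) → AdeleRing (𝓞 K) K))])
          (neg_nonpos.2 (Nat.cast_nonneg k))
      calc M * (1 + ‖vecInfinitePart K (n * n) (0 : Fin (n * n) → AdeleRing (𝓞 K) K)‖) ^ (-(k : ℝ)) ≤ M * 1 :=
            mul_le_mul_of_nonneg_left h1 hM0
        _ = M := mul_one M
    · rw [if_neg hv]
      have hL : GLn.sndHom (n * n) K (kronGL p.1 p.2) ∈
          ((fun q : GL (Fin n) (FiniteAdeleRing (𝓞 K) K) × GL (Fin n) (FiniteAdeleRing (𝓞 K) K) =>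
            kronGL q.1 q.2) ∘ (fun p : GL (Fin n) (AdeleRing (𝓞 K) K) × GL (Fin n) (AdeleRing (𝓞 K) K) =>
              (GLn.sndHom n K p.1, GLn.sndHom n K p.2))) '' Cp := ⟨p, hp, (sndHom_kronGL p.1 p.2).symm⟩
      exact norm_apply_vecMul_le_of_decay hM0 hd' hs' (kronGL p.1 p.2) (hC' _ hL) hG₀0 (hGL p hp) hθ0 hθk hv

end Continuity

/-! ### The matrix theta series is slowly increasing -/

section Main

variable {K : Type} [Field K] [NumberField K] {n : ℕ}

/-- **The matrix theta series grows at most polynomially in the archimedean heights**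
(Godement–Jacquet (1972), §11 Lemma 11.5–11.6 / §12; Jacquet (1979), §1: "the theta series is
slowly increasing"). For `Φ ∈ 𝒮(M_n(𝔸_K))`, compact sets `𝒜, ℬ ⊆ GL_n(𝔸_K^∞)` and
`θ > n² [K:ℚ]` there is `B < ∞` with

  `Σ_{ξ ∈ M_n(K)} |Φ(A ξ B')| ≤ B · (1 ⊔ n⁴ H_∞(A) H_∞(B'))^θ`

for all `A, B' ∈ GL_n(𝔸_K)` with `A_f ∈ 𝒜`, `B'_f ∈ ℬ`: vectorise (`Φ(A ξ B') = Ψ(vec ξ · kron(A, B'))`,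
`apply_mul_ratMatrix_mul_eq`), bound `H_∞(kron(A, B')) ≤ H_∞(A) H_∞(B')` (`archHeight_kronGL_le`),
and apply `exists_tsum_enorm_vecMul_le_archHeight_rpow`. [cite: GodementJacquetLNM260, §11] -/
theorem exists_tsum_enorm_mul_ratMatrix_mul_le {Φ : Matrix (Fin n) (Fin n) (AdeleRing (𝓞 K) K) → ℂ}
    (hΦ : Φ ∈ schwartzBruhatAdelicMatrix n K)
    {𝒜 ℬ : Set (GL (Fin n) (FiniteAdeleRing (𝓞 K) K))} (h𝒜 : IsCompact 𝒜) (hℬ : IsCompact ℬ)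
    {θ : ℝ} (hθ : ((n * n : ℕ) : ℝ) * Module.finrank ℚ K < θ) :
    ∃ B : ℝ≥0∞, B ≠ ⊤ ∧ ∀ A B' : GL (Fin n) (AdeleRing (𝓞 K) K),
      GLn.sndHom n K A ∈ 𝒜 → GLn.sndHom n K B' ∈ ℬ →
        ∑' ξ : Matrix (Fin n) (Fin n) K,
            (‖Φ ((A : Matrix (Fin n) (Fin n) (AdeleRing (𝓞 K) K)) * ratMatrix n K ξ *
              (B' : Matrix (Fin n) (Fin n) (AdeleRing (𝓞 K) K)))‖ₑ : ℝ≥0∞) ≤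
          B * ENNReal.ofReal ((max 1 (((n * n : ℕ) : ℝ) ^ 2 *
            ((GLn.archHeight n K A : ℝ) * (GLn.archHeight n K B' : ℝ)))) ^ θ) := by
  have hθ0 : 0 ≤ θ := le_trans (by positivity) hθ.le
  set k : ℕ := ⌈θ⌉₊ with hk
  have hθk : θ ≤ k := Nat.le_ceil θ
  obtain ⟨M, hM0, Cf, hCfc, hd, hs⟩ :=
    exists_decay_of_mem_piSchwartzBruhat (comp_matOfVec_mem_piSchwartzBruhat hΦ) k
  set 𝒴 : Set (GL (Fin (n * n)) (FiniteAdeleRing (𝓞 K) K)) :=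
    (fun p : GL (Fin n) (FiniteAdeleRing (𝓞 K) K) × GL (Fin n) (FiniteAdeleRing (𝓞 K) K) =>
      kronGL p.1 p.2) '' (𝒜 ×ˢ ℬ) with h𝒴def
  have h𝒴 : IsCompact 𝒴 := (h𝒜.prod hℬ).image continuous_kronGL
  obtain ⟨B, hB, hmain⟩ :=
    exists_tsum_enorm_vecMul_le_archHeight_rpow K (N := n * n) hM0 hd hCfc hs h𝒴 hθ hθk
  refine ⟨B, hB, fun A B' hA hB' => ?_⟩
  have hL : GLn.sndHom (n * n) K (kronGL A B') ∈ 𝒴 :=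
    ⟨(GLn.sndHom n K A, GLn.sndHom n K B'), ⟨hA, hB'⟩, (sndHom_kronGL A B').symm⟩
  have h1 := hmain (kronGL A B') hL
  set g : (Fin (n * n) → K) → ℝ≥0∞ := fun v =>
    (‖(fun x : Fin (n * n) → AdeleRing (𝓞 K) K => Φ (matOfVec x)) (ratVec K v ᵥ*
      ((kronGL A B' : GL (Fin (n * n)) (AdeleRing (𝓞 K) K)) :
        Matrix (Fin (n * n)) (Fin (n * n)) (AdeleRing (𝓞 K) K)))‖ₑ : ℝ≥0∞) with hg
  have hH : (GLn.archHeight (n * n) K (kronGL A B') : ℝ) ≤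
      (GLn.archHeight n K A : ℝ) * (GLn.archHeight n K B' : ℝ) := by
    exact_mod_cast archHeight_kronGL_le A B'
  calc ∑' ξ : Matrix (Fin n) (Fin n) K,
        (‖Φ ((A : Matrix (Fin n) (Fin n) (AdeleRing (𝓞 K) K)) * ratMatrix n K ξ *
          (B' : Matrix (Fin n) (Fin n) (AdeleRing (𝓞 K) K)))‖ₑ : ℝ≥0∞)
      = ∑' ξ : Matrix (Fin n) (Fin n) K, g (vecMatrixEquiv K ξ) := by
        refine tsum_congr fun ξ => ?_
        rw [apply_mul_ratMatrix_mul_eq Φ A B' ξ]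
        rfl
    _ = ∑' v : Fin (n * n) → K, g v := (vecMatrixEquiv K).tsum_eq g
    _ ≤ B * ENNReal.ofReal ((max 1 (((n * n : ℕ) : ℝ) ^ 2 *
          (GLn.archHeight (n * n) K (kronGL A B') : ℝ))) ^ θ) := h1
    _ ≤ B * ENNReal.ofReal ((max 1 (((n * n : ℕ) : ℝ) ^ 2 *
          ((GLn.archHeight n K A : ℝ) * (GLn.archHeight n K B' : ℝ)))) ^ θ) := by
        gcongr

end Main

end Literature.NumberTheory.Automorphic
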